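import Literature.AlgebraicGeometry.Frobenioids.PerfectionIsotropic
import HarnessLib

/-!
# Frobenioids I, Proposition 3.2 (iii) for THE perfection: `C^pf` is of perfect type — the unique lifting
# of pre-steps along arrows of Frobenius type (PROOFS)

Mochizuki, *The geometry of Frobenioids I: the general theory*, Kyushu J. Math. **62** (2008),
Definition 1.2 (iv) "perfect" p. 23, Definition 3.1 (iii) p. 57, Proposition 3.2 (iii) p. 59
[cite: MochizukiFrdI2008, Prop. 3.2 (iii) p.59]: "`C^pf` … is a Frobenioid of perfect and isotropic
type". Proof-only companion (abc-iut cell, node `FrdI:Prop3.2(iii)`, ROW R15 (E)) of abc-iut-L1-d9's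
construction of `C^pf` (`Perfection.lean`, `PerfectionCategory.lean`, `PerfectionOps.lean`) and of its
proofs `PerfectionIsotropic.lean` (isotropic type; existence of `n`-th roots).

Printed route ("immediate from the definitions; Proposition 1.10, (i)", p. 59), made explicit:
* every arrow of `C^pf` is an epimorphism (`C` is totally epimorphic) — `epi_hom`;
* the representatives of arrows `(B₁, m₁) → (B₂, m₂)` and of arrows `(B₁, m₁·n) → (B₂, m₂·n)` are the SAME
  data (an arrow `B₁^{(a)} → B₂^{(b)}` of `C` at a level with `m₁ a = m₂ b`), with the same transports;
  reading a representative at the scaled level is Frobenius-conjugation by the `n`-th power maps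
  (`conj_powerMap_mk`), whence the conjugation `ψ ↦ ψ′`, `ψ ≫ ρ₂ = ρ₁ ≫ ψ′`, of Prop. 1.10 (i) is a
  BIJECTION on `C^pf` (`existsUnique_conj_powerMap`) respecting pre-steps;
* essential uniqueness of arrows of Frobenius type of degree `n` into `(B, m)` (they are the power map up
  to an isomorphism of the domain, `exists_iso_comp_powerMap`, for `C` of Frobenius-isotropic type);
* hence the second clause of "perfect" (`existsUnique_preStep_lift`) and, with the roots of
  `PerfectionIsotropic.lean`, `isOfPerfectType_perfection`.
No new definitions.
-/

namespace Literature.AlgebraicGeometry.Frobenioids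

namespace PreFrobenioid

namespace Perfection

open CategoryTheory Opposite

universe w v v' u u'

variable {D : Type u} [Category.{v} D] {Φ : Dᵒᵖ ⥤ CommMonCat.{w}}
  {C : Type u'} [Category.{v'} C] {F : C ⥤ ElemFrobenioid Φ} {hF : IsFrobenioid F}

/-! ### Every arrow of `C^pf` is an epimorphism -/

/-- Transport of a composite computed at a triple level to a higher triple level (restated from
`Perfection.lift_compAt` for classes): two composites agree as soon as they agree at a common triple level.
[cite: MochizukiFrdI2008, Def. 3.1 (iii) p.57] -/
theorem epi_hom {X Y : Perfection hF} (f : X ⟶ Y) : Epi f := by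
  refine ⟨fun {Z} x y hxy => ?_⟩
  obtain ⟨r, rfl⟩ := Hom.mk_surjective f
  obtain ⟨s, rfl⟩ := Hom.mk_surjective x
  obtain ⟨t, rfl⟩ := Hom.mk_surjective y
  -- compute both composites at one triple level `T` dominating `r`, `s` and `t`
  let T : Level₃ X Y Z := (Level₃.can r s).sup (Level₃.can r t)
  have hr : r.L.LE T.fst := (Level₃.le_can_fst r s).trans (Level₃.le_sup_left _ _).fst
  have hs : s.L.LE T.snd := (Level₃.le_can_snd r s).trans (Level₃.le_sup_left _ _).snd
  have ht : t.L.LE T.snd := (Level₃.le_can_snd r t).trans (Level₃.le_sup_right _ _).snd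
  rw [mk_comp_mk, mk_comp_mk, ← mk_compAt T r s hr hs, ← mk_compAt T r t hr ht] at hxy
  obtain ⟨M, hM, hM', e⟩ := Hom.mk_eq_mk.mp hxy
  -- `M` dominates `T.out`; enlarge `T` to a triple level `T'` with `T'.out ≥ M`
  let T' : Level₃ X Y Z := ⟨T.a * M.a, T.b * M.a, T.c * M.a, by rw [← mul_assoc, T.eq₁, mul_assoc],
    by rw [← mul_assoc, T.eq₂, mul_assoc]⟩
  have hTT' : T.LE T' := ⟨dvd_mul_right _ _, dvd_mul_right _ _, dvd_mul_right _ _⟩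
  have hMT' : M.LE T'.out :=
    ⟨dvd_mul_left _ _, ⟨T.a, by
      have h1 := Level.b_mul_a M T.out
      -- `M.b * T.a = M.a * T.c`
      change M.b * T.a = M.a * T.c at h1
      change T.c * M.a = M.b * T.a
      rw [h1, mul_comm]⟩⟩
  have e' := lift_eq_lift_of_le hM hM' e hMT' hTT'.out hTT'.out
  rw [lift_compAt hTT', lift_compAt hTT'] at e'
  -- cancel the (epimorphic) first factor in `C`
  unfold compAt at e'
  haveI : Epi (Level.lift r.L T'.fst (hr.trans hTT'.fst) r.hom) :=
    hF.isPreFrobenioid.isTotallyEpimorphic.epi _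
  have e'' := (cancel_epi _).mp e'
  rw [← Hom.mk_lift s T'.snd (hs.trans hTT'.snd), ← Hom.mk_lift t T'.snd (ht.trans hTT'.snd), e'']

/-! ### Scaled levels: representatives of `(B₁, m₁) → (B₂, m₂)` versus `(B₁, m₁·n) → (B₂, m₂·n)` -/

section Scaled

variable {B₁ B₂ : C} {m₁ m₂ : ℕ+} (n : ℕ+)

/-- The level equation is invariant under scaling both indices by `n`. [cite: MochizukiFrdI2008, Def. 3.1 (iii) p.57] -/
theorem level_eq_scaled {a b : ℕ+} (h : m₁ * a = m₂ * b) : m₁ * n * a = m₂ * n * b := by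
  rw [mul_right_comm, h, mul_right_comm]

/-- … and conversely. [cite: MochizukiFrdI2008, Def. 3.1 (iii) p.57] -/
theorem level_eq_of_scaled {a b : ℕ+} (h : m₁ * n * a = m₂ * n * b) : m₁ * a = m₂ * b := by
  rw [mul_right_comm, mul_right_comm m₂] at h
  exact mul_right_cancel h

/-- Two representatives agree at the scaled indices iff they agree at the original ones.
[cite: MochizukiFrdI2008, Def. 3.1 (ii) p.56] -/
theorem mk_scaled_eq_iff (s t : Rep (⟨B₁, m₁⟩ : Perfection hF) ⟨B₂, m₂⟩) :
    Hom.mk (X := (⟨B₁, m₁ * n⟩ : Perfection hF)) (Y := ⟨B₂, m₂ * n⟩)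
        ⟨⟨s.L.a, s.L.b, level_eq_scaled n s.L.eq⟩, s.hom⟩ =
      Hom.mk (X := (⟨B₁, m₁ * n⟩ : Perfection hF)) (Y := ⟨B₂, m₂ * n⟩)
        ⟨⟨t.L.a, t.L.b, level_eq_scaled n t.L.eq⟩, t.hom⟩ ↔
    Hom.mk s = Hom.mk t := by
  rw [Hom.mk_eq_mk, Hom.mk_eq_mk]
  constructor
  · rintro ⟨M, hs, ht, e⟩
    exact ⟨⟨M.a, M.b, level_eq_of_scaled n M.eq⟩, hs, ht, e⟩
  · rintro ⟨M, hs, ht, e⟩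
    exact ⟨⟨M.a, M.b, level_eq_scaled n M.eq⟩, hs, ht, e⟩

/-- Every representative at the scaled indices is a representative at the original indices, re-read.
[cite: MochizukiFrdI2008, Def. 3.1 (ii) p.56] -/
theorem exists_rep_scaled (u : Rep (⟨B₁, m₁ * n⟩ : Perfection hF) ⟨B₂, m₂ * n⟩) :
    ∃ s : Rep (⟨B₁, m₁⟩ : Perfection hF) ⟨B₂, m₂⟩,
      u = ⟨⟨s.L.a, s.L.b, level_eq_scaled n s.L.eq⟩, s.hom⟩ :=
  ⟨⟨⟨u.L.a, u.L.b, level_eq_of_scaled n u.L.eq⟩, u.hom⟩, rfl⟩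

/-- The transport of the power-map representative `B^{(1)} → B^{(n)}` to a level `(c, d)` is the transition
`B^{(c)} → B^{(d)}`. [cite: MochizukiFrdI2008, Def. 3.1 (iii) p.57] -/
theorem lift_powerRep {B : C} {m : ℕ+} (L : Level (⟨B, m * n⟩ : Perfection hF) ⟨B, m⟩)
    (h : (⟨1, n, by rw [mul_one]⟩ : Level (⟨B, m * n⟩ : Perfection hF) ⟨B, m⟩).LE L) (hcd : L.a ∣ L.b) :
    Level.lift ⟨1, n, by rw [mul_one]⟩ L h (frobTrans hF B (one_dvd n)) = frobTrans hF B hcd := by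
  apply frobTrans_unique hF B hcd
  have sp := Level.lift_spec (X := (⟨B, m * n⟩ : Perfection hF)) (Y := ⟨B, m⟩)
    ⟨1, n, by rw [mul_one]⟩ L h (frobTrans hF B (one_dvd n))
  change frobTrans hF B h.1 ≫ _ = frobTrans hF B (one_dvd n) ≫ frobTrans hF B h.2 at sp
  rw [frobTrans_trans] at sp
  rw [← frob_frobTrans hF B h.1, Category.assoc, sp, frob_frobTrans]

/-- **Conjugation along the power maps, on representatives**: for a representative `θ : B₁^{(a)} → B₂^{(b)}`
of `ψ′ : (B₁, m₁) → (B₂, m₂)`, the same `θ` read as an arrow `ψ : (B₁, m₁·n) → (B₂, m₂·n)` satisfies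
`ψ ≫ ρ₂ = ρ₁ ≫ ψ′` (both sides are represented by `θ ≫ (B₂^{(b)} → B₂^{(b·n)})` at the level `(a, b·n)`;
the right side by Prop. 1.10 (i)). [cite: MochizukiFrdI2008, Prop. 3.2 (iii) p.59] -/
theorem conj_powerMap_mk (s : Rep (⟨B₁, m₁⟩ : Perfection hF) ⟨B₂, m₂⟩) :
    (Hom.mk (X := (⟨B₁, m₁ * n⟩ : Perfection hF)) (Y := ⟨B₂, m₂ * n⟩)
          ⟨⟨s.L.a, s.L.b, level_eq_scaled n s.L.eq⟩, s.hom⟩ ≫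
        Hom.mk (⟨⟨1, n, mul_one _⟩, frobTrans hF B₂ (one_dvd n)⟩ : Rep (⟨B₂, m₂ * n⟩ : Perfection hF) ⟨B₂, m₂⟩) :
        (⟨B₁, m₁ * n⟩ : Perfection hF) ⟶ ⟨B₂, m₂⟩) =
      (Hom.mk (⟨⟨1, n, mul_one _⟩, frobTrans hF B₁ (one_dvd n)⟩ : Rep (⟨B₁, m₁ * n⟩ : Perfection hF) ⟨B₁, m₁⟩) ≫
        Hom.mk s : (⟨B₁, m₁ * n⟩ : Perfection hF) ⟶ ⟨B₂, m₂⟩) := by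
  obtain ⟨⟨a, b, hab⟩, θ⟩ := s
  -- the representatives involved
  let rp : Rep (⟨B₁, m₁ * n⟩ : Perfection hF) ⟨B₂, m₂ * n⟩ := ⟨⟨a, b, level_eq_scaled n hab⟩, θ⟩
  let pw₁ : Rep (⟨B₁, m₁ * n⟩ : Perfection hF) ⟨B₁, m₁⟩ := ⟨⟨1, n, by rw [mul_one]⟩, frobTrans hF B₁ (one_dvd n)⟩
  let pw₂ : Rep (⟨B₂, m₂ * n⟩ : Perfection hF) ⟨B₂, m₂⟩ := ⟨⟨1, n, by rw [mul_one]⟩, frobTrans hF B₂ (one_dvd n)⟩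
  have hbn : m₂ * n * b = m₂ * (b * n) := by rw [mul_assoc, mul_comm n]
  have han : m₁ * n * a = m₁ * (a * n) := by rw [mul_assoc, mul_comm n]
  have habn : m₁ * (a * n) = m₂ * (b * n) := by rw [← mul_assoc, hab, mul_assoc]
  -- left: triple level `(a, b, b·n)`; right: triple level `(a, a·n, b·n)`
  let T : Level₃ (⟨B₁, m₁ * n⟩ : Perfection hF) ⟨B₂, m₂ * n⟩ ⟨B₂, m₂⟩ :=
    ⟨a, b, b * n, level_eq_scaled n hab, hbn⟩
  let T' : Level₃ (⟨B₁, m₁ * n⟩ : Perfection hF) ⟨B₁, m₁⟩ ⟨B₂, m₂⟩ := ⟨a, a * n, b * n, han, habn⟩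
  have hr : rp.L.LE T.fst := ⟨dvd_rfl, dvd_rfl⟩
  have hs : pw₂.L.LE T.snd := ⟨one_dvd b, dvd_mul_left n b⟩
  have h1 : pw₁.L.LE T'.fst := ⟨one_dvd a, dvd_mul_left n a⟩
  have h2 : (⟨a, b, hab⟩ : Level (⟨B₁, m₁⟩ : Perfection hF) ⟨B₂, m₂⟩).LE T'.snd :=
    ⟨dvd_mul_right a n, dvd_mul_right b n⟩
  have e₁ : Level.lift rp.L T.fst hr θ = θ := Level.lift_rfl _ _ _
  have e₂ : Level.lift pw₂.L T.snd hs (frobTrans hF B₂ (one_dvd n)) = frobTrans hF B₂ (dvd_mul_right b n) :=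
    lift_powerRep n T.snd hs _
  have e₃ : Level.lift pw₁.L T'.fst h1 (frobTrans hF B₁ (one_dvd n)) = frobTrans hF B₁ (dvd_mul_right a n) :=
    lift_powerRep n T'.fst h1 _
  have e₄ : frobTrans hF B₁ (dvd_mul_right a n) ≫
      Level.lift (⟨a, b, hab⟩ : Level (⟨B₁, m₁⟩ : Perfection hF) ⟨B₂, m₂⟩) T'.snd h2 θ =
        θ ≫ frobTrans hF B₂ (dvd_mul_right b n) :=
    Level.lift_spec _ _ h2 θ
  have L : (Hom.mk rp ≫ Hom.mk pw₂ : (⟨B₁, m₁ * n⟩ : Perfection hF) ⟶ ⟨B₂, m₂⟩) =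
      Hom.mk (⟨⟨a, b * n, (level_eq_scaled n hab).trans hbn⟩, θ ≫ frobTrans hF B₂ (dvd_mul_right b n)⟩ :
        Rep (⟨B₁, m₁ * n⟩ : Perfection hF) ⟨B₂, m₂⟩) := by
    rw [mk_comp_mk, ← mk_compAt T rp pw₂ hr hs]
    unfold compAt
    rw [e₁, e₂]
  have R : (Hom.mk pw₁ ≫ Hom.mk ⟨⟨a, b, hab⟩, θ⟩ : (⟨B₁, m₁ * n⟩ : Perfection hF) ⟶ ⟨B₂, m₂⟩) =
      Hom.mk (⟨⟨a, b * n, (level_eq_scaled n hab).trans hbn⟩, θ ≫ frobTrans hF B₂ (dvd_mul_right b n)⟩ :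
        Rep (⟨B₁, m₁ * n⟩ : Perfection hF) ⟨B₂, m₂⟩) := by
    rw [mk_comp_mk, ← mk_compAt T' pw₁ ⟨⟨a, b, hab⟩, θ⟩ h1 h2]
    unfold compAt
    rw [e₃, e₄]
  exact L.trans R.symm

/-- **Conjugation along the power maps is a bijection** (the content of "perfect" for `C^pf`): for every
`ψ′ : (B₁, m₁) → (B₂, m₂)` there is a unique `ψ : (B₁, m₁·n) → (B₂, m₂·n)` with `ψ ≫ ρ₂ = ρ₁ ≫ ψ′`, where
`ρᵢ : (Bᵢ, mᵢ·n) → (Bᵢ, mᵢ)` are the `n`-th power maps — the classes at level `(1, n)` of the transitions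
`Bᵢ^{(1)} → Bᵢ^{(n)}` (Prop. 1.10 (i) gives `ψ ↦ ψ′`; in the perfection the assignment is invertible).
[cite: MochizukiFrdI2008, Prop. 3.2 (iii) p.59] -/
theorem existsUnique_conj_powerMap (ψ' : (⟨B₁, m₁⟩ : Perfection hF) ⟶ ⟨B₂, m₂⟩) :
    ∃! ψ : (⟨B₁, m₁ * n⟩ : Perfection hF) ⟶ ⟨B₂, m₂ * n⟩,
      ψ ≫ Hom.mk (⟨⟨1, n, mul_one _⟩, frobTrans hF B₂ (one_dvd n)⟩ : Rep (⟨B₂, m₂ * n⟩ : Perfection hF) ⟨B₂, m₂⟩) =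
        Hom.mk (⟨⟨1, n, mul_one _⟩, frobTrans hF B₁ (one_dvd n)⟩ : Rep (⟨B₁, m₁ * n⟩ : Perfection hF) ⟨B₁, m₁⟩) ≫
          ψ' := by
  obtain ⟨s, rfl⟩ := Hom.mk_surjective ψ'
  refine ⟨Hom.mk ⟨⟨s.L.a, s.L.b, level_eq_scaled n s.L.eq⟩, s.hom⟩, conj_powerMap_mk n s, fun ψ hψ => ?_⟩
  obtain ⟨u, rfl⟩ := Hom.mk_surjective ψ
  obtain ⟨t, rfl⟩ := exists_rep_scaled n u
  rw [conj_powerMap_mk n t] at hψ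
  haveI := epi_hom
    (Hom.mk (⟨⟨1, n, mul_one _⟩, frobTrans hF B₁ (one_dvd n)⟩ : Rep (⟨B₁, m₁ * n⟩ : Perfection hF) ⟨B₁, m₁⟩))
  exact (mk_scaled_eq_iff n t s).mpr ((cancel_epi _).mp hψ)

/-- The scaled re-reading preserves and reflects pre-steps (same Frobenius degree, same `Base` up to the
same isomorphisms). [cite: MochizukiFrdI2008, Prop. 3.2 (iii) p.59] -/
theorem isPreStep_scaled_iff (s : Rep (⟨B₁, m₁⟩ : Perfection hF) ⟨B₂, m₂⟩) :
    (ops hF).IsPreStep (Hom.mk (X := (⟨B₁, m₁ * n⟩ : Perfection hF)) (Y := ⟨B₂, m₂ * n⟩)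
        ⟨⟨s.L.a, s.L.b, level_eq_scaled n s.L.eq⟩, s.hom⟩) ↔
      (ops hF).IsPreStep (Hom.mk s) :=
  Iff.rfl

end Scaled

/-! ### Essential uniqueness of arrows of Frobenius type in `C^pf` -/

/-- An isomorphism of `C^pf` has Frobenius degree `1`. [cite: MochizukiFrdI2008, Rem. 1.1.1 p.21] -/
theorem degFr_eq_one_of_isIso {X Y : Perfection hF} (e : X ⟶ Y) [IsIso e] : (ops hF).degFr e = 1 := by
  have h := (ops hF).degFr_comp e (inv e)
  rw [IsIso.hom_inv_id, (ops hF).degFr_id] at h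
  have h' : ((ops hF).degFr e : ℕ) * ((ops hF).degFr (inv e) : ℕ) = 1 := by
    rw [← PNat.mul_coe, ← h, PNat.one_coe]
  exact PNat.coe_eq_one_iff.mp (Nat.eq_one_of_mul_eq_one_right h')

/-- An isomorphism of `C^pf` is a pre-step. [cite: MochizukiFrdI2008, Rem. 1.2.1 p.24] -/
theorem isPreStep_of_isIso {X Y : Perfection hF} (e : X ⟶ Y) [IsIso e] : (ops hF).IsPreStep e :=
  ⟨degFr_eq_one_of_isIso e, (inferInstance : IsIso ((ops hF).base.map e))⟩

/-- Pre-steps of `C^pf` are closed under composition. [cite: MochizukiFrdI2008, Prop. 1.7 (i) p.28] -/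
theorem isPreStep_comp {X Y Z : Perfection hF} {f : X ⟶ Y} {g : Y ⟶ Z} (hf : (ops hF).IsPreStep f)
    (hg : (ops hF).IsPreStep g) : (ops hF).IsPreStep (f ≫ g) := by
  refine ⟨?_, ?_⟩
  · change (ops hF).degFr (f ≫ g) = 1
    rw [(ops hF).degFr_comp, show (ops hF).degFr f = 1 from hf.1, show (ops hF).degFr g = 1 from hg.1, mul_one]
  · change IsIso ((ops hF).base.map (f ≫ g))
    rw [Functor.map_comp]
    haveI : IsIso ((ops hF).base.map f) := hf.2
    haveI : IsIso ((ops hF).base.map g) := hg.2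
    infer_instance

/-- **Essential uniqueness of Frobenius-type arrows in `C^pf`** (for `C` of Frobenius-isotropic type): an
arrow of Frobenius type `φ : Z → (B, m)` of Frobenius degree `n` is the `n`-th power map
`(B, m·n) → (B, m)` up to an isomorphism of the domain. (Transport a representative `θ` to a level where its
domain `A^{(a)}` is isotropic — Def. 1.3 (vii)(b) along a Frobenius arrow `A → A′` to an isotropic `A′`;
there `θ` is co-angular (Prop. 1.4 (i)), an isometric base-isomorphism of degree `n`, i.e. of Frobenius type
in `C`, hence isomorphic under `A^{(a)}` to the transition `A^{(a)} → A^{(a·n)}` (Def. 1.3 (ii)); the inverse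
comparison isomorphism, read at the level `(a·n, b)`, is the required isomorphism of `C^pf`.)
[cite: MochizukiFrdI2008, Prop. 3.2 (iii) p.59] -/
theorem exists_iso_comp_powerMap (hiso : IsOfType (IsFrobeniusIsotropic F)) {Z : Perfection hF} {B : C}
    {m : ℕ+} (φ : Z ⟶ (⟨B, m⟩ : Perfection hF)) (hφ : (ops hF).IsFrobeniusType φ) {n : ℕ+}
    (hn : (ops hF).degFr φ = n) :
    ∃ e : Z ⟶ (⟨B, m * n⟩ : Perfection hF), IsIso e ∧
      e ≫ Hom.mk (⟨⟨1, n, mul_one _⟩, frobTrans hF B (one_dvd n)⟩ : Rep (⟨B, m * n⟩ : Perfection hF) ⟨B, m⟩) = φ := by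
  obtain ⟨r, rfl⟩ := Hom.mk_surjective φ
  obtain ⟨A', φ₀, hφ₀, hA'⟩ := hiso Z.obj
  -- transport to the level `(a·d, b·d)`, `d = deg_Fr(φ₀)`, where the domain becomes isotropic
  let L' : Level Z (⟨B, m⟩ : Perfection hF) :=
    ⟨r.L.a * PreFrobenioid.degFr F φ₀, r.L.b * PreFrobenioid.degFr F φ₀, by rw [← mul_assoc, r.L.eq, mul_assoc]⟩
  have hle : r.L.LE L' := ⟨dvd_mul_right _ _, dvd_mul_right _ _⟩
  have hZa : IsIsotropic F (frobPow hF Z.obj L'.a) := isIsotropic_frobPow hF hφ₀ hA' (dvd_mul_left _ _)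
  -- the transported representative is of Frobenius type in `C`, of degree `n`
  have hdeg : PreFrobenioid.degFr F (Level.lift r.L L' hle r.hom) = n :=
    (degFr_lift r.L L' hle r.hom).trans hn
  have hbase : IsIso (Base F (Level.lift r.L L' hle r.hom)) := by
    apply (isIso_base_hom_iff ⟨L', _⟩).mpr
    have e := baseMap_lift r.L L' hle r.hom
    change IsIso (Rep.baseMap ⟨L', Level.lift r.L L' hle r.hom⟩)
    rw [e]
    exact hφ.2
  have hdiv : Div F (Level.lift r.L L' hle r.hom) = 1 := by
    apply (div_eq_one_iff ⟨L', _⟩).mp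
    have e := div_lift r.L L' hle r.hom
    change Rep.div ⟨L', Level.lift r.L L' hle r.hom⟩ = 1
    rw [e]
    exact hφ.1.2
  have hco : PreFrobenioid.IsCoAngular F (Level.lift r.L L' hle r.hom) :=
    isCoAngular_of_isIsotropic_codomains F _ fun _ f => hF.vii_b f hZa
  have hFr : IsFrobeniusType F (Level.lift r.L L' hle r.hom) := ⟨⟨hco, hdiv⟩, hbase⟩
  -- Def. 1.3 (ii): it is the transition `A^{(a')} → A^{(a'·n)}` up to an isomorphism under `A^{(a')}`
  have hdeg' : PreFrobenioid.degFr F (frobTrans hF Z.obj (dvd_mul_right L'.a n)) = n :=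
    mul_left_cancel (degFr_frobTrans hF Z.obj (dvd_mul_right L'.a n))
  obtain ⟨j, hj⟩ := hF.ii_unique _ _ hFr (isFrobeniusType_frobTrans hF Z.obj (dvd_mul_right L'.a n))
    (hdeg.trans hdeg'.symm)
  -- the isomorphism `e`, read at the level `(a'·n, b')`
  have heq : Z.idx * (L'.a * n) = m * n * L'.b := by
    rw [← mul_assoc, L'.eq, mul_right_comm]
  let re : Rep Z (⟨B, m * n⟩ : Perfection hF) := ⟨⟨L'.a * n, L'.b, heq⟩, j.inv⟩
  refine ⟨Hom.mk re, isIso_mk_of_isIso re (inferInstance : IsIso j.inv), ?_⟩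
  -- both sides are represented by `j⁻¹ ≫ (B^{(b')} → B^{(b'·n)})` at the level `(a'·n, b'·n)`
  let pw : Rep (⟨B, m * n⟩ : Perfection hF) ⟨B, m⟩ := ⟨⟨1, n, by rw [mul_one]⟩, frobTrans hF B (one_dvd n)⟩
  have hbn : m * n * L'.b = m * (L'.b * n) := by rw [mul_assoc, mul_comm n]
  let T : Level₃ Z (⟨B, m * n⟩ : Perfection hF) ⟨B, m⟩ := ⟨L'.a * n, L'.b, L'.b * n, heq, hbn⟩
  have hr : re.L.LE T.fst := ⟨dvd_rfl, dvd_rfl⟩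
  have hs : pw.L.LE T.snd := ⟨one_dvd _, dvd_mul_left n _⟩
  have e₁ : Level.lift re.L T.fst hr j.inv = j.inv := Level.lift_rfl _ _ _
  have e₂ : Level.lift pw.L T.snd hs (frobTrans hF B (one_dvd n)) = frobTrans hF B (dvd_mul_right L'.b n) :=
    lift_powerRep n T.snd hs _
  have L : (Hom.mk re ≫ Hom.mk pw : Z ⟶ ⟨B, m⟩) =
      Hom.mk (⟨T.out, j.inv ≫ frobTrans hF B (dvd_mul_right L'.b n)⟩ : Rep Z (⟨B, m⟩ : Perfection hF)) := by
    rw [mk_comp_mk, ← mk_compAt T re pw hr hs]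
    unfold compAt
    rw [e₁, e₂]
  -- the right side: lift `r` to `L'`, then to `T.out = (a'·n, b'·n)`
  have hle' : L'.LE T.out := ⟨dvd_mul_right _ _, dvd_mul_right _ _⟩
  have e₃ : j.inv ≫ frobTrans hF B (dvd_mul_right L'.b n) = Level.lift L' T.out hle' (Level.lift r.L L' hle r.hom) :=
    Level.lift_unique L' T.out hle' (by
      change frobTrans hF Z.obj (dvd_mul_right L'.a n) ≫ j.inv ≫ frobTrans hF B (dvd_mul_right L'.b n) =
        Level.lift r.L L' hle r.hom ≫ frobTrans hF B (dvd_mul_right L'.b n)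
      rw [← hj, Category.assoc, j.hom_inv_id_assoc])
  rw [L, ← Hom.mk_lift r L' hle, ← Hom.mk_lift ⟨L', Level.lift r.L L' hle r.hom⟩ T.out hle']
  change Hom.mk (⟨T.out, j.inv ≫ frobTrans hF B (dvd_mul_right L'.b n)⟩ : Rep Z (⟨B, m⟩ : Perfection hF)) =
    Hom.mk ⟨T.out, Level.lift L' T.out hle' (Level.lift r.L L' hle r.hom)⟩
  rw [e₃]

/-! ### The second clause of "perfect" and Proposition 3.2 (iii), perfect type -/

/-- **Unique lifting of pre-steps along arrows of Frobenius type** in `C^pf` — the second clause of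
"perfect" (Def. 1.2 (iv)), for `C` of Frobenius-isotropic type: given arrows of Frobenius type
`φ₁ : X₁ → (B₁, m₁)`, `φ₂ : X₂ → (B₂, m₂)` of the same degree `n` and a pre-step `ψ′ : (B₁, m₁) → (B₂, m₂)`,
there is a unique pre-step `ψ : X₁ → X₂` with `ψ ≫ φ₂ = φ₁ ≫ ψ′` (reduce to the power maps by essential
uniqueness, then invert the conjugation of Prop. 1.10 (i) by `existsUnique_conj_powerMap`).
[cite: MochizukiFrdI2008, Prop. 3.2 (iii) p.59] -/
theorem existsUnique_preStep_lift (hiso : IsOfType (IsFrobeniusIsotropic F)) {X₁ X₂ : Perfection hF}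
    {B₁ B₂ : C} {m₁ m₂ : ℕ+} (φ₁ : X₁ ⟶ (⟨B₁, m₁⟩ : Perfection hF)) (φ₂ : X₂ ⟶ (⟨B₂, m₂⟩ : Perfection hF))
    (h₁ : (ops hF).IsFrobeniusType φ₁) (h₂ : (ops hF).IsFrobeniusType φ₂) {n : ℕ+}
    (hn₁ : (ops hF).degFr φ₁ = n) (hn₂ : (ops hF).degFr φ₂ = n)
    (ψ' : (⟨B₁, m₁⟩ : Perfection hF) ⟶ ⟨B₂, m₂⟩) (hψ' : (ops hF).IsPreStep ψ') :
    ∃! ψ : X₁ ⟶ X₂, (ops hF).IsPreStep ψ ∧ ψ ≫ φ₂ = φ₁ ≫ ψ' := by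
  obtain ⟨e₁, he₁, rfl⟩ := exists_iso_comp_powerMap hiso φ₁ h₁ hn₁
  obtain ⟨e₂, he₂, rfl⟩ := exists_iso_comp_powerMap hiso φ₂ h₂ hn₂
  haveI := he₁
  haveI := he₂
  obtain ⟨χ, hχ, hχu⟩ := existsUnique_conj_powerMap n ψ'
  -- `χ` is a pre-step: it is represented by a representative of `ψ'` re-read at the scaled indices
  have hχp : (ops hF).IsPreStep χ := by
    obtain ⟨s, rfl⟩ := Hom.mk_surjective ψ'
    have hs := conj_powerMap_mk n s
    rw [← hχu _ hs]
    exact (isPreStep_scaled_iff n s).mpr hψ'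
  refine ⟨e₁ ≫ χ ≫ inv e₂, ⟨?_, ?_⟩, ?_⟩
  · exact isPreStep_comp (isPreStep_of_isIso e₁) (isPreStep_comp hχp (isPreStep_of_isIso (inv e₂)))
  · simp only [Category.assoc, IsIso.inv_hom_id_assoc, hχ]
  · rintro ψ ⟨-, hψ⟩
    have hconj : (inv e₁ ≫ ψ ≫ e₂) ≫
        Hom.mk (⟨⟨1, n, mul_one _⟩, frobTrans hF B₂ (one_dvd n)⟩ : Rep (⟨B₂, m₂ * n⟩ : Perfection hF) ⟨B₂, m₂⟩) =
          Hom.mk (⟨⟨1, n, mul_one _⟩, frobTrans hF B₁ (one_dvd n)⟩ : Rep (⟨B₁, m₁ * n⟩ : Perfection hF) ⟨B₁, m₁⟩) ≫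
            ψ' := by
      simp only [Category.assoc]
      rw [hψ, Category.assoc, IsIso.inv_hom_id_assoc]
    have := hχu _ hconj
    rw [← this]
    simp only [Category.assoc, IsIso.hom_inv_id, Category.comp_id, IsIso.hom_inv_id_assoc]

/-- Every object of `C^pf` is **perfect** (Def. 1.2 (iv)), for `C` of Frobenius-isotropic type: roots exist
(`exists_frobeniusType_to`, seat abc-iut-L1-d9) and pre-steps lift uniquely along arrows of Frobenius type.
[cite: MochizukiFrdI2008, Prop. 3.2 (iii) p.59] -/
theorem isPerfectObj (hiso : IsOfType (IsFrobeniusIsotropic F)) (X : Perfection hF) : (ops hF).IsPerfectObj X := by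
  intro n
  refine ⟨fun Y _ => exists_frobeniusType_to hF Y n, ?_⟩
  intro X₁ Y₁ X₂ Y₂ φ₁ φ₂ _ _ h₁ hn₁ h₂ hn₂ ψ' hψ'
  obtain ⟨B₁, m₁⟩ := Y₁
  obtain ⟨B₂, m₂⟩ := Y₂
  exact existsUnique_preStep_lift hiso φ₁ φ₂ h₁ h₂ hn₁ hn₂ ψ' hψ'

/-- **Proposition 3.2 (iii), perfect-type clause**, for THE perfection of a Frobenioid of Frobenius-isotropic
type: `C^pf` is of perfect type (the conjunct `P.ops.IsOfPerfectType` of `Prop32iii` in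
`BaseCategoryTheoreticityDefs.lean`, seat abc-iut-L1-t3, at the datum `PreFrobenioidData.perfection hF`).
[cite: MochizukiFrdI2008, Prop. 3.2 (iii) p.59] -/
theorem isOfPerfectType_perfection (hF : IsFrobenioid F) (hiso : IsOfType (IsFrobeniusIsotropic F)) :
    (ops hF).IsOfPerfectType :=
  ⟨fun X => isPerfectObj hiso X⟩

/-- **Proposition 3.2 (iii)**, the first two conjuncts AS TYPED (`Prop32iii (ofFunctor Φ F) (perfection hF) PP`
minus the `(C^pf)^pf ≃ C^pf` clause, which is about a second datum `PP`): the perfection of a Frobenioid of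
Frobenius-isotropic type is of perfect and of isotropic type. [cite: MochizukiFrdI2008, Prop. 3.2 (iii) p.59] -/
theorem perfection_isOfPerfectType_and_isOfIsotropicType (hF : IsFrobenioid F)
    (hiso : IsOfType (IsFrobeniusIsotropic F)) :
    (PreFrobenioidData.perfection hF).ops.IsOfPerfectType ∧ (PreFrobenioidData.perfection hF).ops.IsOfIsotropicType :=
  ⟨isOfPerfectType_perfection hF hiso, isOfIsotropicType_perfection hF hiso⟩

/-- **Proposition 3.2 (iii) AS TYPED, modulo its third conjunct**: `Prop32iii` (`BaseCategoryTheoreticityDefs.lean`,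
seat abc-iut-L1-t3) holds for THE perfection datum `PreFrobenioidData.perfection hF` of a Frobenioid of
Frobenius-isotropic type and any perfection datum `PP` of `C^pf` whose functor `C^pf → (C^pf)^pf` IS an
equivalence — i.e. the conjuncts "perfect type" and "isotropic type" are discharged here, while "the natural
equivalence `C^pf ≃ (C^pf)^pf`" is taken as the hypothesis `hPP` (CONDITIONAL: forming THE perfection of `C^pf`
needs "`C^pf` is a Frobenioid", Thm. 3.4 (iii) / Prop. 5.6, not yet in the tree).
[cite: MochizukiFrdI2008, Prop. 3.2 (iii) p.59] -/
theorem prop32iii_of_toPf_isEquivalence (hF : IsFrobenioid F) (hiso : IsOfType (IsFrobeniusIsotropic F))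
    (PP : PerfectionData (PreFrobenioidData.perfection hF).ops) (hPP : PP.toPf.IsEquivalence) :
    Prop32iii (PreFrobenioidData.ofFunctor Φ F) (PreFrobenioidData.perfection hF) PP :=
  ⟨isOfPerfectType_perfection hF hiso, isOfIsotropicType_perfection hF hiso, hPP⟩

end Perfection

end PreFrobenioid

end Literature.AlgebraicGeometry.Frobenioids
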